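import Summits.BirchSwinnertonDyer.BirchSwinnertonDyer.Theorems.ManinLocalTwoThreeEtaIdentitiesOneTwentyEightC
import Summits.BirchSwinnertonDyer.BirchSwinnertonDyer.Theorems.ManinLocalTwoThreeNeronSqueeze
import Summits.BirchSwinnertonDyer.Rank1Residual.Additive.IntModelConductorCertificate
import HarnessLib

/-!
# Level 128 (`v₂(N) = 7`), class `128c`: the Néron squeeze for `128c1 = [0, -1, 0, 1, -1]` — `|c| = 1` for every `X₀(128)`-datum whose
# newform is `φ₁₂₈c`; `N(128c1) = 128` in the kernel

Cell bsd-f2-manin, route `ManinLocalTwoThree` (crux C2 `ManinOddAtFour` stmt-22967; `128 = 2⁷` is the deepest `2`-adic level of the charter's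
`v₂(N) ∈ {5,…,8}` cell — "twist-minimal classes with no semistable partner", where no CDT-free classical input was available), prover seat p3
gen 24; level-`128` instance of the general NÉRON SQUEEZE (`NeronSqueeze.abs_maninConstant_eq_one_of_periodLattice_le`) fed with (S2)₁₂₈c of
`EtaIdentitiesOneTwentyEightC` (UNCONDITIONAL, E₂ road).

* §1 `128c1 = [0, -1, 0, 1, -1] : y² = x³ − x² + x − 1`: elliptic, globally minimal (`Δ = −2⁸`), **`N(128c1) = 128`** by kernel certificates
  (type `III` at `2` after `x ↦ x + r`: `4 ∣ a₆'`, `2² ∥ b₈' = 28`, `f₂ = 8 + 1 − 2 = 7`; good reduction at `3`), Néron invariants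
  `(c₄/12, c₆/216) = (−8/3, 80/27)`;
* §2 **`abs_maninConstant_eq_one_oneTwentyEightC_of_f_eq`**: for every globally minimal elliptic `W/ℚ` and every `X₀(128)`-datum `D` of `W` with the lattice
  clause AND `⇑D.f = φ₁₂₈c`: `|c(D)| = 1`, hence `2 ∤ c` (and `3 ∤ c`).

HONEST FRAMING: unconditional (standard axioms) but ONLY for data whose newform is `φ₁₂₈c`: the level-`96` statement needs the classes `128b, 128c, 128d`
and the newform pinning (an-g51 pinsolve-128), neither here.  C2 (`∀ N`), Manin's conjecture and BSD are NOT proved; item 22967 stays OPEN.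
No definition, no named fact, no sorry. [cite: AgasheRibetStein2006, §§1–2] [cite: CremonaAlgorithms1997, Table 1 (128c1)] [cite: Silverman1994, IV.9.4]
-/

set_option autoImplicit false
-- lint-debt: the directory name repeats the summit name (sibling precedent `ManinLocalTwoThreeNeronSqueezeSixtyFour.lean`)
set_option linter.dupNamespace false

noncomputable section

open Complex Filter Topology Set Function
open UpperHalfPlane hiding I
open scoped Real Topology Manifold MatrixGroups ModularForm
open ModularForm CongruenceSubgroup WeierstrassCurve
open Summit.BirchSwinnertonDyer.BirchSwinnertonDyer.Rank2Observatory
open Summit.BirchSwinnertonDyer.BirchSwinnertonDyer.Rank2Observatory.RootNumber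
open Summit.BirchSwinnertonDyer.BirchSwinnertonDyer.Rank2Observatory.Tate
open Summit.BirchSwinnertonDyer.Rank1Residual.Additive
open Literature.NumberTheory.EllipticCurves Literature.NumberTheory.EllipticCurves.ModularForms
open Literature.NumberTheory.Automorphic

namespace Summit.BirchSwinnertonDyer.BirchSwinnertonDyer.Theorems.ManinLocalTwoThree.NeronSqueezeOneTwentyEightC

open EtaIdentitiesOneTwentyEightC

/-! ## §1 `128c1` -/

/-- The literal `ℚ`-model read through integer casts. [folklore] -/
theorem mk_oneTwentyEightC1_eq_cast : (⟨0, -1, 0, 1, -1⟩ : WeierstrassCurve ℚ) = ⟨((0 : ℤ) : ℚ), ((-1 : ℤ) : ℚ), ((0 : ℤ) : ℚ), ((1 : ℤ) : ℚ), ((-1 : ℤ) : ℚ)⟩ := by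
  ext <;> norm_num

/-- `128c1` is globally minimal (`Δ = −2⁸`; kernel certificate). [cite: SilvermanAEC2009, VII.1 Remark 1.1] -/
theorem isGloballyMinimal_oneTwentyEightC1 : (⟨0, -1, 0, 1, -1⟩ : WeierstrassCurve ℚ).IsGloballyMinimal := by
  rw [mk_oneTwentyEightC1_eq_cast]
  exact IntModelCond.isGloballyMinimal_mk_of_minCheck 0 (-1) 0 (1) (-1) (cm := ⟨8, 5, 7, []⟩) (by decide +kernel)

/-- `128c1` is an elliptic curve (`Δ = −256 ≠ 0`); a theorem, use `haveI`. [folklore] -/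
theorem isElliptic_oneTwentyEightC1 : (⟨0, -1, 0, 1, -1⟩ : WeierstrassCurve ℚ).IsElliptic :=
  ⟨by norm_num [WeierstrassCurve.Δ, WeierstrassCurve.b₂, WeierstrassCurve.b₄, WeierstrassCurve.b₆, WeierstrassCurve.b₈]⟩

/-- **`N(128c1) = 96 = 2⁵·3`**: Step-3 certificate at `2` (translation `x ↦ x + r`, `r = ∓1`; `4 ∣ a₆'`, `2² ∥ b₈'`: type `III`, `f₂ = 7`) and good reduction at `3`; kernel-checked, minimality included. [cite: Silverman1994, IV.9.4] [cite: CremonaAlgorithms1997, Table 1 (128c1)] -/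
theorem conductorNorm_oneTwentyEightC1 : (⟨0, -1, 0, 1, -1⟩ : WeierstrassCurve ℚ).conductorNorm ℤ = 128 := by
  rw [mk_oneTwentyEightC1_eq_cast]
  exact IntModelCond.conductorNorm_mk_eq_of_certs_of_eq 0 (-1) 0 (1) (-1)
    (cm := ⟨8, 5, 7, []⟩) (c := ⟨8, 5, 7, 0, 0, 0, []⟩)
    (l₂ := ⟨2, -1, 0, 0, 8, 3, 2⟩) (l₃ := ⟨0, 0, 0, 0, 0, 0, 0⟩)
    (by decide +kernel) (by decide +kernel) (by decide +kernel) (by decide +kernel) (by decide +kernel)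

/-- **The Néron invariants of `128c1`**: `c₄ = −32`, `c₆ = 640`; `(g₂, g₃) = (−8/3, 80/27) ⟹ IsNeronLatticeOf`. [cite: CremonaAlgorithms1997, Table 1 (128c1)] -/
theorem isNeronLatticeOf_oneTwentyEightC1 {L₁ : PeriodPair} (hg2 : L₁.g₂ = -8 / 3) (hg3 : L₁.g₃ = 80 / 27) :
    IsNeronLatticeOf ((⟨0, -1, 0, 1, -1⟩ : WeierstrassCurve ℚ).baseChange ℂ) L₁ := by
  constructor
  · rw [hg2]
    norm_num [WeierstrassCurve.baseChange, WeierstrassCurve.map_c₄, WeierstrassCurve.c₄,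
      WeierstrassCurve.b₂, WeierstrassCurve.b₄]
  · rw [hg3]
    norm_num [WeierstrassCurve.baseChange, WeierstrassCurve.map_c₆, WeierstrassCurve.c₆,
      WeierstrassCurve.b₂, WeierstrassCurve.b₄, WeierstrassCurve.b₆]

/-! ## §2 The squeeze for the class `96c` -/

/-- **`|c| = 1` for every `X₀(128)`-datum whose newform is `φ₁₂₈c`** — UNCONDITIONAL. [cite: AgasheRibetStein2006, §§1–2] -/
theorem abs_maninConstant_eq_one_oneTwentyEightC_of_f_eq (W : WeierstrassCurve ℚ) [W.IsElliptic] [W.IsGloballyMinimal]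
    (D : ModularParametrizationData W 128)
    (hf : ⇑D.f = fun τ ↦ (-(4 * etaQuotient 128 (expFn [(8, 1), (16, 1), (32, -1), (64, 1), (128, 2)]) τ) - 2 * etaQuotient 128 (expFn [(8, 1), (16, 1), (32, -3), (64, 7), (128, -2)]) τ + 4 * etaQuotient 128 (expFn [(8, 1), (32, 1), (64, 2)]) τ + 2 * etaQuotient 128 (expFn [(8, 1), (16, -1), (32, 5), (64, -3), (128, 2)]) τ + etaQuotient 128 (expFn [(8, 1), (16, -1), (32, 3), (64, 3), (128, -2)]) τ + 2 * etaQuotient 128 (expFn [(8, 1), (16, -2), (32, 7), (64, -2)]) τ))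
    (hopt : ∀ z ∈ D.L.lattice, ∃ w ∈ periodLattice D.f, z = D.c * w) :
    |D.maninConstant| = 1 := by
  haveI := isElliptic_oneTwentyEightC1
  haveI := isGloballyMinimal_oneTwentyEightC1
  obtain ⟨L₁, hg2, hg3, hle⟩ := periodLatticeLe_oneTwentyEight D.f hf
  exact NeronSqueeze.abs_maninConstant_eq_one_of_periodLattice_le (⟨0, -1, 0, 1, -1⟩ : WeierstrassCurve ℚ) L₁
    (isNeronLatticeOf_oneTwentyEightC1 hg2 hg3) W D hle hopt

/-- `2 ∤ c` and `3 ∤ c` for every `X₀(128)`-datum whose newform is `φ₁₂₈c` — UNCONDITIONAL. [folklore] -/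
theorem not_dvd_maninConstant_oneTwentyEightC_of_f_eq (W : WeierstrassCurve ℚ) [W.IsElliptic] [W.IsGloballyMinimal]
    (D : ModularParametrizationData W 128)
    (hf : ⇑D.f = fun τ ↦ (-(4 * etaQuotient 128 (expFn [(8, 1), (16, 1), (32, -1), (64, 1), (128, 2)]) τ) - 2 * etaQuotient 128 (expFn [(8, 1), (16, 1), (32, -3), (64, 7), (128, -2)]) τ + 4 * etaQuotient 128 (expFn [(8, 1), (32, 1), (64, 2)]) τ + 2 * etaQuotient 128 (expFn [(8, 1), (16, -1), (32, 5), (64, -3), (128, 2)]) τ + etaQuotient 128 (expFn [(8, 1), (16, -1), (32, 3), (64, 3), (128, -2)]) τ + 2 * etaQuotient 128 (expFn [(8, 1), (16, -2), (32, 7), (64, -2)]) τ))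
    (hopt : ∀ z ∈ D.L.lattice, ∃ w ∈ periodLattice D.f, z = D.c * w) :
    ¬ (2 : ℤ) ∣ D.maninConstant ∧ ¬ (3 : ℤ) ∣ D.maninConstant := by
  have h := abs_maninConstant_eq_one_oneTwentyEightC_of_f_eq W D hf hopt
  refine ⟨fun h2 ↦ ?_, fun h3 ↦ ?_⟩
  · have := Int.le_of_dvd (by rw [h]; norm_num) ((dvd_abs _ _).mpr h2)
    rw [h] at this
    norm_num at this
  · have := Int.le_of_dvd (by rw [h]; norm_num) ((dvd_abs _ _).mpr h3)
    rw [h] at this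
    norm_num at this

/-- **Modularity at `128c1`, levelled**: under `exists_isNewformOf`, the curve has a newform in `S₂(Γ₀(96))`.  CONDITIONAL on the items' binder.
[cite: DiamondShurman2005, Thm. 8.8.3] -/
theorem exists_isNewformOf_oneTwentyEightC1 (hnf : exists_isNewformOf) :
    ∃ f : CuspForm (Gamma0 128) 2, IsNewformOf (⟨0, -1, 0, 1, -1⟩ : WeierstrassCurve ℚ) f := by
  haveI := isElliptic_oneTwentyEightC1
  have key : ∀ (N : ℕ) [NeZero N], (⟨0, -1, 0, 1, -1⟩ : WeierstrassCurve ℚ).conductorNorm ℤ = N →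
      ∃ f : CuspForm (Gamma0 N) 2, IsNewformOf (⟨0, -1, 0, 1, -1⟩ : WeierstrassCurve ℚ) f := by
    intro N _ hN
    subst hN
    exact hnf _
  haveI : NeZero (128 : ℕ) := ⟨by decide⟩
  exact key 128 conductorNorm_oneTwentyEightC1

end Summit.BirchSwinnertonDyer.BirchSwinnertonDyer.Theorems.ManinLocalTwoThree.NeronSqueezeOneTwentyEightC

end
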